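import Summits.HodgeConjecture.HodgeConjecture.Theorems.Ring2AbelianAllAndreSporadicClasses
import HarnessLib

/-!
# Ring 2 · sub-cell AbelianAll (ALL ABELIAN VARIETIES), André axis, part XXXI-b — SPORADIC ALGEBRAIC CLASSES, THE
# NODES: (4) `CMAnchoredTransport` ⟺ (4_ℵ) "a class algebraic on a CM fibre of a compact pencil of abelian varieties
# is algebraic on UNCOUNTABLY many fibres" and (2) ⟺ (2_ℵ), both with NO named fact; hence `HC_AV ⟺ HC_CM ∧ (4_ℵ)`
# modulo Lemme 6.3.1 ALONE; (L) ⟺ (4_ℵ), (L∀) ⟺ (2_ℵ) modulo Verdier; and the PER-PENCIL RUNG "`HC` in degree `2p`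
# at uncountably many members of ONE pencil ⟹ the lift `(L)_t(p)` at every `t` of it"

HONEST FRAMING (page 1, verbatim): **research route, not a corollary; conditional on HC_CM plus one named
minimal statement.** Cell line: research route conditional on HC_CM; not a corollary; Q11.4-sentence-2 already
refuted in dim ≥ 3. Nothing in this file proves a case of the Hodge conjecture for an abelian variety. `HC_CM`
(`Theses.RankFourFaces.CMAbelianHodge`) and `HC_AV` (`Theses.PadicSemiregularLift.HodgeAbelianVarieties`) are
BINDERS wherever they occur; `hGT` = Verdier's generic local triviality and `h₂₁` = André's Lemme 6.3.1 are
NAMED-FACT BINDERS; the reduction item `CMToAbelian` (stmt-HodgeConjecture-16267) is NOT closed here; the cell's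
`B_min` of record (N104) is untouched; NO node is born (0 `def`), nothing is claimed minimal.

## Content (sequel of part XXXI-a, whose §2 dichotomy "countable or everything" is the one input beyond the nodes)

* §6 **NODES**: `cmAnchoredTransport_iff_not_countable` — (4) ⟺ (4_ℵ) "on every compact pencil of abelian varieties,
  a class of the total space algebraic on a CM fibre is algebraic on uncountably many fibres", FACT-FREE (the tree's
  algebraicity-locus theorem); `compactAbelianPencilVHC_iff_not_countable` — deform's (2) ⟺ (2_ℵ), fact-free (the
  compact-pencil, residual-free form of seat b02's `AbelianSchemeVHC ⟺ (U)`); (L) ⟺ (4_ℵ) and (L∀) ⟺ (2_ℵ) modulo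
  Verdier; **`HC_AV ⟺ HC_CM ∧ (4_ℵ)` and `CMToAbelian ⟺ (HC_CM → (4_ℵ))` modulo Lemme 6.3.1 ONLY** (part I's rows
  composed with the fact-free equivalence — no Verdier in the cell row); on-path `HodgeConjecture ⟹ (4_ℵ)`.
* §7 [Verdier] **PER-PENCIL RUNG** `comap_le_sup_of_not_countable_hodge_of_verdier`: if the fibres over an
  UNCOUNTABLE set of complex points of ONE compact pencil of abelian `d`-folds satisfy the Hodge conjecture in degree
  `2p`, then `(j_t^*)⁻¹ Nᵖ(𝒳_t) ≤ Nᵖ(𝒳) ⊔ ker j_t^*` at EVERY `t` of that pencil; with `HodgeConjectureFor d` at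
  uncountably many members, the lattice identity in all degrees and Abdulali's (1.1)_f
  (`invariantCyclesHoldFor_of_not_countable_hodgeConjectureFor_of_verdier`). Part XIX-c's `comap_le_sup_of_hcAtDim`
  (`HC` for ALL abelian `d`-folds, `SpreadCurve[]`) localised to one pencil, one degree, a very general set of members.
* §8 [Verdier] **ANCHORS** `exists_countable_forall_transport_of_verdier`: all but countably many fibres of a pencil
  are anchors — every class algebraic there is algebraic on every fibre; `B_min` on `f` ⟺ no CM point of `f` is in
  the countable exceptional set.

READING (RING2-MAP §AbelianAll (ab-andre-2, gen 23)). `B_min` in the shape (4_ℵ): "no SPORADIC algebraic class at a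
CM fibre of a compact pencil of abelian varieties" — sporadic = algebraic on that fibre and on only countably many
others. By part XXXI-a §4 the fibres carrying a sporadic class are countably many on every pencil; by §7 there are
none on a pencil whose very general member satisfies `HC` in the relevant degree. On the pencils Lemme 6.3.1 attaches
to an abelian variety the very general member carries the same invariant Hodge classes as the CM fibre, so §7 marks
WHERE the statement has content (the exceptional habitats of the Weil seats), not a way round it.

EDGE LABELS: §6 (2)/(4) rows and the on-path row fact-free, `HC_AV`/`CMToAbelian` rows K[6.3.1], (L)/(L∀) rows
K[Verdier]; §7, §8 K[Verdier]. No `def`, no `sorry`; axioms standard.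

References: CharlesSchnell2014Notes (Prop. 11.3.11 (proof), Conj. 11.3.1, Prop. 11.3.5, Cor. 11.3.6); Verdier1976
(Cor. (5.1)); Andre1996Motifs (§5.1 (A3)–(A4) p. 25, §6.3 Lemme 6.3.1 p. 31, a) and Remarque 2 p. 33);
Milne2020HodgeClassesAV (Prop. 1); Abdulali1994FamiliesAV ((1.1) p. 1122); Grothendieck1966 (footnote 13);
DeligneHodgeII1971 (Thm. 4.1.1, Cor. 4.1.2).
-/

noncomputable section

set_option linter.dupNamespace false

namespace Summit.HodgeConjecture.HodgeConjecture.Ring2.AbelianAll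

open CategoryTheory AlgebraicGeometry
open Literature.AlgebraicGeometry Literature.AlgebraicGeometry.Motives
open Literature.AlgebraicGeometry.HodgeTheory
open Literature.AlgebraicGeometry.Andre1996 (andre1996_cmAnchoredPencil)
open Literature.AlgebraicGeometry.Deligne1982 (cmLocus)
open Summit.HodgeConjecture.HodgeConjecture
open Summit.HodgeConjecture.HodgeConjecture.Theses
open Summit.HodgeConjecture.HodgeConjecture.Ring2.Deform (CompactAbelianPencilVHC HC_CM_of_HC_AV)

variable {𝒳 S : SchemeOver ℂ}

/-! ## §6 The nodes: (4) ⟺ (4_ℵ) and (2) ⟺ (2_ℵ) with no named fact; the cell rows -/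

/-- **(4) ⟺ (4_ℵ), FACT-FREE: `CMAnchoredTransport` ⟺ "on every compact pencil of abelian varieties, a class of
the total space algebraic on a CM fibre is algebraic on UNCOUNTABLY many fibres".** (⟹: all fibres, and `S(ℂ)` is
uncountable; ⟸: §2, the tree's algebraicity-locus theorem.) [cite: Andre1996Motifs, §6.3 a) (p. 33)]
[cite: CharlesSchnell2014Notes, Prop. 11.3.11 (proof)] [cite: Grothendieck1966, footnote 13] -/
theorem cmAnchoredTransport_iff_not_countable :
    CMAnchoredTransport ↔ ∀ ⦃d : ℕ⦄ ⦃𝒳 S : SchemeOver ℂ⦄ (f : 𝒳 ⟶ S), IsCompactAbelianPencil f d →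
      ∀ (p : ℕ) (W : complexBetti 𝒳 (2 * p)), ∀ t ∈ cmLocus f d,
        complexBetti.map (fiberι f t) (2 * p) W ∈ algebraicClasses (fiberOver f t) p →
        ¬ {s : ComplexPoints S |
          complexBetti.map (fiberι f s) (2 * p) W ∈ algebraicClasses (fiberOver f s) p}.Countable := by
  rw [cmAnchoredTransport_iff_complex]
  refine ⟨fun h d 𝒳 S f hf p W t ht h₀ ↦ ?_, fun h d 𝒳 S f hf p W t ht h₀ s ↦ ?_⟩
  · exact not_countable_of_forall_mem_of_curve hf.isSmoothProjective_base t (h f hf p W t ht h₀)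
  · exact forall_mem_algebraicClasses_of_not_countable' hf W (h f hf p W t ht h₀) s

/-- **(2) ⟺ (2_ℵ), FACT-FREE: deform's `CompactAbelianPencilVHC` ⟺ "on every compact pencil of abelian varieties,
a class of the total space algebraic on ONE fibre is algebraic on UNCOUNTABLY many".** The compact-pencil,
residual-free form of seat b02's row `AbelianSchemeVHC ⟺ (U)`. [cite: Grothendieck1966, footnote 13]
[cite: CharlesSchnell2014Notes, Conj. 11.3.1 and Prop. 11.3.11 (proof)] -/
theorem compactAbelianPencilVHC_iff_not_countable :
    CompactAbelianPencilVHC ↔ ∀ ⦃d : ℕ⦄ ⦃𝒳 S : SchemeOver ℂ⦄ (f : 𝒳 ⟶ S), IsCompactAbelianPencil f d →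
      ∀ (p : ℕ) (W : complexBetti 𝒳 (2 * p)) (s₀ : ComplexPoints S),
        complexBetti.map (fiberι f s₀) (2 * p) W ∈ algebraicClasses (fiberOver f s₀) p →
        ¬ {s : ComplexPoints S |
          complexBetti.map (fiberι f s) (2 * p) W ∈ algebraicClasses (fiberOver f s) p}.Countable := by
  rw [compactAbelianPencilVHC_iff_complex]
  refine ⟨fun h d 𝒳 S f hf p W s₀ h₀ ↦ ?_, fun h d 𝒳 S f hf p W hs₀ s ↦ ?_⟩
  · exact not_countable_of_forall_mem_of_curve hf.isSmoothProjective_base s₀ (h f hf p W ⟨s₀, h₀⟩)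
  · obtain ⟨s₀, h₀⟩ := hs₀
    exact forall_mem_algebraicClasses_of_not_countable' hf W (h f hf p W s₀ h₀) s

/-- **(L) ⟺ (4_ℵ), granted Verdier**: the cycle-theoretic lift at CM fibres ⟺ no sporadic algebraic class at a CM
fibre of a compact pencil of abelian varieties. [cite: Verdier1976, Cor. (5.1)] [cite: Andre1996Motifs, §5.1 (p. 25) and §6.3 a) (p. 33)] -/
theorem cmFibreAlgebraicLift_iff_not_countable_of_verdier (hGT : Verdier1976_genericLocalTriviality) :
    CMFibreAlgebraicLift ↔ ∀ ⦃d : ℕ⦄ ⦃𝒳 S : SchemeOver ℂ⦄ (f : 𝒳 ⟶ S), IsCompactAbelianPencil f d →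
      ∀ (p : ℕ) (W : complexBetti 𝒳 (2 * p)), ∀ t ∈ cmLocus f d,
        complexBetti.map (fiberι f t) (2 * p) W ∈ algebraicClasses (fiberOver f t) p →
        ¬ {s : ComplexPoints S |
          complexBetti.map (fiberι f s) (2 * p) W ∈ algebraicClasses (fiberOver f s) p}.Countable :=
  (cmFibreAlgebraicLift_iff_cmAnchoredTransport_of_verdier hGT).trans cmAnchoredTransport_iff_not_countable

/-- **(L∀) ⟺ (2_ℵ), granted Verdier**: the algebraic fixed part ⟺ no compact pencil of abelian varieties carries
a sporadic algebraic class at any fibre. [cite: Verdier1976, Cor. (5.1)] [cite: Milne2020HodgeClassesAV, Prop. 1 (p. 7)] -/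
theorem algebraicFixedPart_iff_not_countable_of_verdier (hGT : Verdier1976_genericLocalTriviality) :
    AlgebraicFixedPart ↔ ∀ ⦃d : ℕ⦄ ⦃𝒳 S : SchemeOver ℂ⦄ (f : 𝒳 ⟶ S), IsCompactAbelianPencil f d →
      ∀ (p : ℕ) (W : complexBetti 𝒳 (2 * p)) (s₀ : ComplexPoints S),
        complexBetti.map (fiberι f s₀) (2 * p) W ∈ algebraicClasses (fiberOver f s₀) p →
        ¬ {s : ComplexPoints S |
          complexBetti.map (fiberι f s) (2 * p) W ∈ algebraicClasses (fiberOver f s) p}.Countable :=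
  (algebraicFixedPart_iff_compactAbelianPencilVHC_of_verdier hGT).trans compactAbelianPencilVHC_iff_not_countable

/-- **THE CELL ROW, modulo Lemme 6.3.1 ALONE: `HC_AV ⟺ HC_CM ∧ (4_ℵ)`** — the Hodge conjecture for all abelian
varieties ⟺ its CM case AND "on every compact pencil of abelian varieties, a class of the total space algebraic
on a CM fibre is algebraic on uncountably many fibres" (part I's `HC_AV_iff_HC_CM_and_cmAnchoredTransport` + the
fact-free (4) ⟺ (4_ℵ)). `HC_CM` is a conjunct, never a fact; no Verdier.
[cite: Andre1996Motifs, Lemme 6.3.1 (p. 31) and Remarque 2 (p. 33)] [cite: CharlesSchnell2014Notes, Cor. 11.3.6 and Prop. 11.3.11] -/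
theorem HC_AV_iff_HC_CM_and_not_countable (h₂₁ : andre1996_cmAnchoredPencil) :
    PadicSemiregularLift.HodgeAbelianVarieties ↔ (RankFourFaces.CMAbelianHodge ∧
      ∀ ⦃d : ℕ⦄ ⦃𝒳 S : SchemeOver ℂ⦄ (f : 𝒳 ⟶ S), IsCompactAbelianPencil f d →
        ∀ (p : ℕ) (W : complexBetti 𝒳 (2 * p)), ∀ t ∈ cmLocus f d,
          complexBetti.map (fiberι f t) (2 * p) W ∈ algebraicClasses (fiberOver f t) p →
          ¬ {s : ComplexPoints S |
            complexBetti.map (fiberι f s) (2 * p) W ∈ algebraicClasses (fiberOver f s) p}.Countable) := by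
  rw [HC_AV_iff_HC_CM_and_cmAnchoredTransport h₂₁, cmAnchoredTransport_iff_not_countable]

/-- The same as a one-way row with `HC_CM` and (4_ℵ) as explicit hypotheses (the cell's deliverable shape
`HC_CM → B → HC_AV`, `B` := (4_ℵ)), modulo Lemme 6.3.1. [cite: Andre1996Motifs, Lemme 6.3.1 (p. 31) and §6.3 a) (p. 33)] -/
theorem HC_AV_of_HC_CM_of_not_countable (h₂₁ : andre1996_cmAnchoredPencil) (hCM : RankFourFaces.CMAbelianHodge)
    (hB : ∀ ⦃d : ℕ⦄ ⦃𝒳 S : SchemeOver ℂ⦄ (f : 𝒳 ⟶ S), IsCompactAbelianPencil f d →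
      ∀ (p : ℕ) (W : complexBetti 𝒳 (2 * p)), ∀ t ∈ cmLocus f d,
        complexBetti.map (fiberι f t) (2 * p) W ∈ algebraicClasses (fiberOver f t) p →
        ¬ {s : ComplexPoints S |
          complexBetti.map (fiberι f s) (2 * p) W ∈ algebraicClasses (fiberOver f s) p}.Countable) :
    PadicSemiregularLift.HodgeAbelianVarieties :=
  (HC_AV_iff_HC_CM_and_not_countable h₂₁).2 ⟨hCM, hB⟩

/-- **The reduction item read through (4_ℵ)**: granted Lemme 6.3.1, `CMToAbelian ⟺ (HC_CM → (4_ℵ))`. Nothing here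
closes the item. [cite: Andre1996Motifs, Lemme 6.3.1 (p. 31)] -/
theorem cmToAbelian_iff_HC_CM_imp_not_countable (h₂₁ : andre1996_cmAnchoredPencil) :
    RankFourFaces.CMToAbelian ↔ (RankFourFaces.CMAbelianHodge →
      ∀ ⦃d : ℕ⦄ ⦃𝒳 S : SchemeOver ℂ⦄ (f : 𝒳 ⟶ S), IsCompactAbelianPencil f d →
        ∀ (p : ℕ) (W : complexBetti 𝒳 (2 * p)), ∀ t ∈ cmLocus f d,
          complexBetti.map (fiberι f t) (2 * p) W ∈ algebraicClasses (fiberOver f t) p →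
          ¬ {s : ComplexPoints S |
            complexBetti.map (fiberι f s) (2 * p) W ∈ algebraicClasses (fiberOver f s) p}.Countable) := by
  rw [cmToAbelian_iff_HC_CM_imp_cmAnchoredTransport h₂₁, cmAnchoredTransport_iff_not_countable]

/-- ON-PATH: the summit gives (4_ℵ) (through (4)). [folklore] -/
theorem not_countable_of_hodgeConjecture (h : _root_.HodgeConjecture) :
    ∀ ⦃d : ℕ⦄ ⦃𝒳 S : SchemeOver ℂ⦄ (f : 𝒳 ⟶ S), IsCompactAbelianPencil f d →
      ∀ (p : ℕ) (W : complexBetti 𝒳 (2 * p)), ∀ t ∈ cmLocus f d,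
        complexBetti.map (fiberι f t) (2 * p) W ∈ algebraicClasses (fiberOver f t) p →
        ¬ {s : ComplexPoints S |
          complexBetti.map (fiberι f s) (2 * p) W ∈ algebraicClasses (fiberOver f s) p}.Countable :=
  cmAnchoredTransport_iff_not_countable.1 (cmAnchoredTransport_of_hodgeConjecture h)

/-! ## §7 The per-pencil rung: `HC` in degree `2p` at uncountably many members gives `(L)_t(p)` at every `t` -/

/-- **PER-PENCIL RUNG, GRANTED VERDIER.** Let `f : 𝒳 ⟶ S` be a compact pencil of abelian `d`-folds and `p` a degree
such that the fibres over an UNCOUNTABLE set of complex points satisfy the Hodge conjecture in degree `2p` (every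
rational `(p,p)`-class algebraic). Then `(j_t^*)⁻¹ Nᵖ(𝒳_t) ≤ Nᵖ(𝒳) ⊔ ker j_t^*` at EVERY `t`: a rational class of
the total space algebraic on `𝒳_t` is rational of type `(p,p)` on every fibre (part XVII-a,
`fibrewiseHodge_of_isRationalClass_of_mem_algebraicClasses`), hence algebraic on the uncountably many good fibres,
hence (§3) lifted; general classes by part XVII-b's reduction to rational ones. Part XIX-c's `comap_le_sup_of_hcAtDim`
(`HC` for ALL abelian `d`-folds, all degrees) localised to one pencil, one degree, a very general set of members.
[cite: Verdier1976, Cor. (5.1)] [cite: CharlesSchnell2014Notes, Prop. 11.3.5, Cor. 11.3.6 and Prop. 11.3.11]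
[cite: DeligneHodgeII1971, Thm. 4.1.1 and Cor. 4.1.2] -/
theorem comap_le_sup_of_not_countable_hodge_of_verdier (hGT : Verdier1976_genericLocalTriviality) {d : ℕ}
    {f : 𝒳 ⟶ S} (hf : IsCompactAbelianPencil f d) (p : ℕ)
    (hHC : ¬ {s : ComplexPoints S | ∀ c : complexBetti (fiberOver f s) (2 * p), IsRationalClass c →
      IsOfHodgeType d (fiberOver f s) (2 * p) p p c → c ∈ algebraicClasses (fiberOver f s) p}.Countable)
    (t : ComplexPoints S) :
    (algebraicClasses (fiberOver f t) p).comap (complexBetti.map (fiberι f t) (2 * p)).hom ≤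
      algebraicClasses 𝒳 p ⊔ LinearMap.ker (complexBetti.map (fiberι f t) (2 * p)).hom := by
  intro W hW
  have hW' : complexBetti.map (fiberι f t) (2 * p) W ∈ algebraicClasses (fiberOver f t) p := hW
  refine (Submodule.span_le (p := algebraicClasses 𝒳 p ⊔
    LinearMap.ker (complexBetti.map (fiberι f t) (2 * p)).hom)).2 ?_
    (mem_span_rational_of_map_fiberι_mem_algebraicClasses hf hW')
  rintro W' ⟨hW'rat, hW'alg⟩
  -- `W'` is algebraic on every good fibre, an uncountable set
  have hgood : ¬ {s : ComplexPoints S |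
      complexBetti.map (fiberι f s) (2 * p) W' ∈ algebraicClasses (fiberOver f s) p}.Countable := by
    refine fun hc ↦ hHC (hc.mono fun s hs ↦ ?_)
    have hH := fibrewiseHodge_of_isRationalClass_of_mem_algebraicClasses hf hW'rat hW'alg s
    exact hs _ hH.1 hH.2
  obtain ⟨η, hη, hηW'⟩ := exists_algebraic_lift_of_not_countable_of_verdier' hGT hf W' hgood
  change W' ∈ algebraicClasses 𝒳 p ⊔ LinearMap.ker (complexBetti.map (fiberι f t) (2 * p)).hom
  rw [show W' = η + (W' - η) by abel]
  refine Submodule.add_mem_sup hη ?_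
  rw [LinearMap.mem_ker, map_sub, sub_eq_zero]
  exact (hηW' t).symm

/-- The lattice identity from the per-pencil rung: `(j_t^*)⁻¹ Nᵖ(𝒳_t) = Nᵖ(𝒳) ⊔ ker j_t^*` at every `t`.
[cite: Verdier1976, Cor. (5.1)] [cite: Milne2020HodgeClassesAV, Prop. 1 (p. 7)] -/
theorem comap_eq_sup_of_not_countable_hodge_of_verdier (hGT : Verdier1976_genericLocalTriviality) {d : ℕ}
    {f : 𝒳 ⟶ S} (hf : IsCompactAbelianPencil f d) (p : ℕ)
    (hHC : ¬ {s : ComplexPoints S | ∀ c : complexBetti (fiberOver f s) (2 * p), IsRationalClass c →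
      IsOfHodgeType d (fiberOver f s) (2 * p) p p c → c ∈ algebraicClasses (fiberOver f s) p}.Countable)
    (t : ComplexPoints S) :
    (algebraicClasses (fiberOver f t) p).comap (complexBetti.map (fiberι f t) (2 * p)).hom =
      algebraicClasses 𝒳 p ⊔ LinearMap.ker (complexBetti.map (fiberι f t) (2 * p)).hom :=
  le_antisymm (comap_le_sup_of_not_countable_hodge_of_verdier hGT hf p hHC t) (algebraicClasses_sup_ker_le_comap hf p t)

/-- **From `HodgeConjectureFor` at uncountably many members**: if the fibres over an uncountable set of complex points
of a compact pencil of abelian `d`-folds satisfy `HodgeConjectureFor d`, then `(j_t^*)⁻¹ Nᵖ(𝒳_t) = Nᵖ(𝒳) ⊔ ker j_t^*`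
at every `t` in every degree, granted Verdier. [cite: Verdier1976, Cor. (5.1)] [cite: CharlesSchnell2014Notes, Cor. 11.3.6] -/
theorem comap_eq_sup_of_not_countable_hodgeConjectureFor_of_verdier (hGT : Verdier1976_genericLocalTriviality)
    {d : ℕ} {f : 𝒳 ⟶ S} (hf : IsCompactAbelianPencil f d)
    (hHC : ¬ {s : ComplexPoints S | HodgeConjectureFor d (fiberOver f s)}.Countable) (p : ℕ) (t : ComplexPoints S) :
    (algebraicClasses (fiberOver f t) p).comap (complexBetti.map (fiberι f t) (2 * p)).hom =
      algebraicClasses 𝒳 p ⊔ LinearMap.ker (complexBetti.map (fiberι f t) (2 * p)).hom :=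
  comap_eq_sup_of_not_countable_hodge_of_verdier hGT hf p
    (fun hc ↦ hHC (hc.mono fun _ hs c hc' hpp ↦ hs.2 p c hc' hpp)) t

/-- **Abdulali's transport (1.1)_f on a pencil whose very general member satisfies `HC`**, granted Verdier: the
subspaces `(j_s^*)⁻¹ Nᵖ(𝒳_s)` all equal `Nᵖ(𝒳) ⊔ ker j_s^*`, which does not depend on `s` (part XVII-c,
`algebraicClasses_sup_ker_eq`), so part XVII-b's lattice form of (1.1)_f applies.
[cite: Abdulali1994FamiliesAV, (1.1) (p. 1122)] [cite: Verdier1976, Cor. (5.1)] -/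
theorem invariantCyclesHoldFor_of_not_countable_hodgeConjectureFor_of_verdier
    (hGT : Verdier1976_genericLocalTriviality) {d : ℕ} {f : 𝒳 ⟶ S} (hf : IsCompactAbelianPencil f d)
    (hHC : ¬ {s : ComplexPoints S | HodgeConjectureFor d (fiberOver f s)}.Countable) :
    Abdulali1994.InvariantCyclesHoldFor f d := by
  rw [invariantCyclesHoldFor_iff_comap_eq hf]
  intro p s s'
  rw [comap_eq_sup_of_not_countable_hodgeConjectureFor_of_verdier hGT hf hHC p s,
    comap_eq_sup_of_not_countable_hodgeConjectureFor_of_verdier hGT hf hHC p s', algebraicClasses_sup_ker_eq hf p s s']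

/-! ## §8 Anchors: all but countably many fibres of a pencil are anchors, granted Verdier -/

/-- **ALL BUT COUNTABLY MANY FIBRES ARE ANCHORS, granted Verdier.** On a smooth projective family over a smooth
projective curve with smooth projective total space there is a countable `E ⊆ S(ℂ)` such that for every `t ∉ E`,
EVERY class of the total space algebraic on `𝒳_t` is algebraic on EVERY fibre (part XXXI-a §4 and §5). Deform's (2)
asks this at every `t`; the André-axis `B_min` (4) asks it at the CM points: `B_min` on a pencil `f` ⟺ no CM point of
`f` lies in this countable exceptional set. [cite: Verdier1976, Cor. (5.1)] [cite: CharlesSchnell2014Notes, Cor. 11.3.6 and Prop. 11.3.11]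
[cite: Andre1996Motifs, §6.3 a) (p. 33)] -/
theorem exists_countable_forall_transport_of_verdier (hGT : Verdier1976_genericLocalTriviality) {d : ℕ}
    {f : 𝒳 ⟶ S} (hS : IsSmoothProjective 1 S) (h𝒳 : IsSmoothProjective (d + 1) 𝒳)
    (hf : IsSmoothProjectiveFamily f d) :
    ∃ E : Set (ComplexPoints S), E.Countable ∧ ∀ t ∉ E, ∀ (p : ℕ) (W : complexBetti 𝒳 (2 * p)),
      complexBetti.map (fiberι f t) (2 * p) W ∈ algebraicClasses (fiberOver f t) p →
      ∀ s : ComplexPoints S, complexBetti.map (fiberι f s) (2 * p) W ∈ algebraicClasses (fiberOver f s) p := by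
  obtain ⟨E, hE, h⟩ := exists_countable_forall_comap_le_sup_of_verdier hGT hS h𝒳 hf
  exact ⟨E, hE, fun t ht p W hW s ↦ forall_mem_algebraicClasses_of_comap_le_sup hS hf (h t ht p) hW s⟩

/-- The same on a compact pencil of abelian varieties. [cite: Verdier1976, Cor. (5.1)] [cite: Andre1996Motifs, §6.3 a) (p. 33)] -/
theorem exists_countable_forall_transport_of_verdier' (hGT : Verdier1976_genericLocalTriviality) {d : ℕ}
    {f : 𝒳 ⟶ S} (hf : IsCompactAbelianPencil f d) :
    ∃ E : Set (ComplexPoints S), E.Countable ∧ ∀ t ∉ E, ∀ (p : ℕ) (W : complexBetti 𝒳 (2 * p)),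
      complexBetti.map (fiberι f t) (2 * p) W ∈ algebraicClasses (fiberOver f t) p →
      ∀ s : ComplexPoints S, complexBetti.map (fiberι f s) (2 * p) W ∈ algebraicClasses (fiberOver f s) p :=
  exists_countable_forall_transport_of_verdier hGT hf.isSmoothProjective_base hf.isSmoothProjective_total
    hf.isSmoothProjectiveFamily

end Summit.HodgeConjecture.HodgeConjecture.Ring2.AbelianAll

end
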